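import Summits.HodgeConjecture.CorCM.CommonQuarticCMSubfieldSimpleFourfolds
import Literature.NumberTheory.ComplexMultiplication.CommonAbelianCMSubfieldDegenerate
import HarnessLib

/-!
# An octic CM field over a quartic CM subfield: the involution `τ`, anti-real generators, the real base field
# `F = z(k⁺)`, and the fibres of the two restriction maps (to `k` and to the second quartic CM subfield)

COR-CM (cell `pub-hodgecm2`, binder seat `b16` gen 50, count-neutral claim CM44-COMMONQUARTIC, file F3; theorems only,
no definition, no named fact, no `sorry`).  NEW as packaged, hence under `Summits/`; the number-theoretic dress that
discharges the hypotheses of `CorCM/TwoFibreTypesFieldOfDefinition` §2 and feeds `CorCM/CommonQuarticCMSubfield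
ReflexCoincidences` (F2).  `HC_CM` is neither used nor asserted.

SETTING.  `K` a CM field with `[K:ℚ] = 2[k:ℚ]` over a CM field `k` along `e : k → K` (for the `(4,4)` cell: `K` octic,
`k` quartic), `ρ` = `complexConj`.

* §1 `exists_algEquiv_over`: the non-trivial automorphism `τ` of `K` over `e(k)` (`K/k` is quadratic, hence Galois);
  `algEquiv_over_apply_apply` (`τ² = 1`), `exists_apply_eq_of_fix` (`Fix τ = e(k)`), `comp_eq_comp_iff` (the fibre of
  `y ↦ y ∘ e` through `x` is `{x, x ∘ τ}`).
* §2 `complexConj_comm`, `complexConj_apply_ringHom` (`ρ` commutes with automorphisms and with `e`).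
* §3 ANTI-REAL GENERATORS: `exists_antireal` (`a ∈ k`, `ā = −a ≠ 0`), `exists_real_add_real_mul` (`k = k⁺ ⊕ k⁺a`),
  `exists_antireal_anti` (`b ∈ K`, `ρb = τb = −b ≠ 0`: an anti-real element of the SECOND quartic CM subfield
  `k′ = Fix(ρτ)`), `exists_real_apply_eq_mul_self` (`b² ∈ e(k⁺)`).
* §4 THE REAL BASE FIELD `F = normalClosure ℚ k⁺ ℂ = z(k⁺)` for EVERY place `z` (`k⁺` is quadratic, hence normal,
  when `[k:ℚ] = 4`): `apply_mem_normalClosure`, `exists_apply_eq_of_mem_normalClosure`, `conj_apply_of_mem_normalClosure`.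
* §5 `eq_or_eq_conj_smul_of_forall_real` (places agreeing on `k⁺` are equal or conjugate),
  **`eq_or_eq_conj_smul_comp_of_agree`** (an embedding agreeing with `x` on `e(k⁺)` and at `b` is `x` or `\overline{x∘τ}`
  — the fibre over the place `x|_{k′}` of the second subfield, WITHOUT constructing `k′`).
* The FIELD OF DEFINITION `F(z₁(a), x₂(b))` of a one-unsplit-pair type is derived from §5 in the sequel
  `CorCM/CommonQuarticCMSubfieldFieldOfDefinition`.

## References

* [Shimura1998] G. Shimura, *Abelian Varieties with Complex Multiplication and Modular Functions*, §8.3, §8.4 (2)(C),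
  §18.1–18.2.
* [Lang2002] S. Lang, *Algebra*, V §2 Thm. 2.8, VI §1 (Artin; quadratic extensions are Galois).
* [Streng2010] M. Streng, *Complex multiplication of abelian surfaces*, Ch. I §3, Lemma I.3.4.
-/

set_option autoImplicit false

noncomputable section

open scoped ComplexConjugate
open NumberField NumberField.ComplexEmbedding Module

namespace Summit.HodgeConjecture.CorCM.OcticOverQuartic

open Literature.NumberTheory.ComplexMultiplication
open Literature.AlgebraicGeometry.Motives (CMType)
open Literature.AlgebraicGeometry.Pohlmann1968

/-! ### §1 The involution of `K` over `e(k)` -/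

section Involution

variable {k K : Type} [Field k] [NumberField k] [Field K] [NumberField K]

/-- **`K/e(k)` quadratic has a non-trivial automorphism over `e(k)`** (a quadratic extension in characteristic `0` is
Galois with group of order `2`). [cite: Lang2002, VI §1] -/
theorem exists_algEquiv_over (e : k →+* K) (h2 : finrank ℚ K = 2 * finrank ℚ k) :
    ∃ τ : K ≃ₐ[ℚ] K, τ ≠ 1 ∧ ∀ x : k, τ (e x) = e x := by
  classical
  letI : Algebra k K := e.toAlgebra
  haveI : IsScalarTower ℚ k K := IsScalarTower.of_algebraMap_eq fun q => (map_ratCast e q).symm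
  haveI : FiniteDimensional k K := Module.Finite.of_restrictScalars_finite ℚ k K
  have hfin : finrank k K = 2 := by
    have h := Module.finrank_mul_finrank ℚ k K
    rw [h2, mul_comm 2] at h
    exact Nat.eq_of_mul_eq_mul_left finrank_pos h
  haveI : Algebra.IsQuadraticExtension k K := ⟨hfin⟩
  haveI : Algebra.IsSeparable k K := Algebra.IsAlgebraic.isSeparable_of_perfectField
  have hcard : Fintype.card (K ≃ₐ[k] K) = 2 := by
    rw [← Nat.card_eq_fintype_card, IsGalois.card_aut_eq_finrank, hfin]
  obtain ⟨τ, hτ⟩ := Fintype.exists_ne_of_one_lt_card (by rw [hcard]; norm_num) (1 : K ≃ₐ[k] K)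
  refine ⟨τ.restrictScalars ℚ, fun h => hτ (AlgEquiv.ext fun x => ?_), fun x => τ.commutes x⟩
  exact AlgEquiv.congr_fun h x

/-- The `e(k)`-automorphisms of `K` are `1` and `τ` (the group has order `[K : e(k)] = 2`); hence **`τ² = 1`** and
**`Fix(τ) = e(k)`**. [cite: Lang2002, VI §1 Thm. 1.8 (Artin)] -/
theorem algEquiv_over_apply_apply_and_fix (e : k →+* K) (h2 : finrank ℚ K = 2 * finrank ℚ k) (τ : K ≃ₐ[ℚ] K)
    (hτ1 : τ ≠ 1) (hτe : ∀ x : k, τ (e x) = e x) :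
    (∀ t : K, τ (τ t) = t) ∧ ∀ t : K, τ t = t → ∃ x : k, e x = t := by
  classical
  letI : Algebra k K := e.toAlgebra
  haveI : IsScalarTower ℚ k K := IsScalarTower.of_algebraMap_eq fun q => (map_ratCast e q).symm
  haveI : FiniteDimensional k K := Module.Finite.of_restrictScalars_finite ℚ k K
  have hfin : finrank k K = 2 := by
    have h := Module.finrank_mul_finrank ℚ k K
    rw [h2, mul_comm 2] at h
    exact Nat.eq_of_mul_eq_mul_left finrank_pos h
  haveI : Algebra.IsQuadraticExtension k K := ⟨hfin⟩
  haveI : Algebra.IsSeparable k K := Algebra.IsAlgebraic.isSeparable_of_perfectField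
  have hcard : Fintype.card (K ≃ₐ[k] K) = 2 := by
    rw [← Nat.card_eq_fintype_card, IsGalois.card_aut_eq_finrank, hfin]
  -- `τ` as a `k`-algebra automorphism
  let τk : K ≃ₐ[k] K := AlgEquiv.ofRingEquiv (f := τ.toRingEquiv) fun x => hτe x
  have hτk : ∀ t, τk t = τ t := fun t => rfl
  have hτk1 : τk ≠ 1 := fun h => hτ1 (AlgEquiv.ext fun t => by rw [← hτk, h]; rfl)
  -- every element is `1` or `τk`
  have hall : ∀ g : K ≃ₐ[k] K, g = 1 ∨ g = τk := by
    intro g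
    by_contra hg
    rw [not_or] at hg
    have h3 : ({1, τk, g} : Finset (K ≃ₐ[k] K)).card = 3 := by
      rw [Finset.card_insert_of_notMem, Finset.card_pair (Ne.symm hg.2)]
      simp only [Finset.mem_insert, Finset.mem_singleton, not_or]
      exact ⟨hτk1.symm, (Ne.symm hg.1)⟩
    have := Finset.card_le_univ ({1, τk, g} : Finset (K ≃ₐ[k] K))
    rw [h3, hcard] at this
    omega
  refine ⟨fun t => ?_, fun t ht => ?_⟩
  · rcases hall (τk * τk) with h | h
    · have := AlgEquiv.congr_fun h t
      rwa [AlgEquiv.mul_apply, hτk, hτk] at this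
    · exact absurd (mul_eq_left.1 h) hτk1
  · have hmem : t ∈ IntermediateField.fixedField (⊤ : Subgroup (K ≃ₐ[k] K)) := by
      rw [IntermediateField.mem_fixedField_iff]
      intro g _
      rcases hall g with rfl | rfl
      · rfl
      · rw [hτk, ht]
    rw [IsGalois.fixedField_top, IntermediateField.mem_bot] at hmem
    obtain ⟨x, hx⟩ := hmem
    exact ⟨x, hx⟩

/-- `τ² = 1`. [cite: Lang2002, VI §1] -/
theorem algEquiv_over_apply_apply (e : k →+* K) (h2 : finrank ℚ K = 2 * finrank ℚ k) (τ : K ≃ₐ[ℚ] K)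
    (hτ1 : τ ≠ 1) (hτe : ∀ x : k, τ (e x) = e x) (t : K) : τ (τ t) = t :=
  (algEquiv_over_apply_apply_and_fix e h2 τ hτ1 hτe).1 t

/-- `Fix(τ) = e(k)`. [cite: Lang2002, VI §1 Thm. 1.8 (Artin)] -/
theorem exists_apply_eq_of_fix (e : k →+* K) (h2 : finrank ℚ K = 2 * finrank ℚ k) (τ : K ≃ₐ[ℚ] K) (hτ1 : τ ≠ 1)
    (hτe : ∀ x : k, τ (e x) = e x) {t : K} (ht : τ t = t) : ∃ x : k, e x = t :=
  (algEquiv_over_apply_apply_and_fix e h2 τ hτ1 hτe).2 t ht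

/-- **The fibre of `y ↦ y ∘ e` through `x` is `{x, x ∘ τ}`.** [cite: Lang2002, V §2 Thm. 2.8] -/
theorem comp_eq_comp_iff (e : k →+* K) (h2 : finrank ℚ K = 2 * finrank ℚ k) (τ : K ≃ₐ[ℚ] K) (hτ1 : τ ≠ 1)
    (hτe : ∀ x : k, τ (e x) = e x) (x y : K →+* ℂ) :
    y.comp e = x.comp e ↔ y = x ∨ y = x.comp τ.toRingEquiv.toRingHom := by
  have hxτ : (x.comp τ.toRingEquiv.toRingHom).comp e = x.comp e :=
    RingHom.ext fun t => by simp only [RingHom.comp_apply]; exact congrArg x (hτe t)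
  constructor
  · intro h
    rcases forall_eq_or_eq_comp_eq e h2 y x (x.comp τ.toRingEquiv.toRingHom) h hxτ.symm with h' | h' | h'
    · exact Or.inl h'
    · exfalso
      apply hτ1
      refine AlgEquiv.ext fun t => ?_
      have := RingHom.congr_fun h' t
      simp only [RingHom.comp_apply] at this
      exact (x.injective this).symm
    · exact Or.inr h'
  · rintro (rfl | rfl)
    · rfl
    · exact hxτ

end Involution

/-! ### §2 Complex conjugation commutes with automorphisms and with `e` -/

section Conj

variable {k K : Type} [Field k] [NumberField k] [Field K] [NumberField K] [IsCMField K]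

/-- `ρ` commutes with every automorphism of the CM field `K` (read through a complex embedding).
[cite: Shimura1998, §18.2 Lemma (i)] -/
theorem complexConj_comm (g : K ≃ₐ[ℚ] K) (t : K) :
    IsCMField.complexConj K (g t) = g (IsCMField.complexConj K t) := by
  let φ : K →+* ℂ := Classical.choice inferInstance
  apply φ.injective
  rw [IsCMField.complexEmbedding_complexConj]
  have h1 : (φ.comp g.toRingEquiv.toRingHom) (IsCMField.complexConj K t) = conj ((φ.comp g.toRingEquiv.toRingHom) t) :=
    IsCMField.complexEmbedding_complexConj K _ t
  exact h1.symm

/-- `ρ_K ∘ e = e ∘ ρ_k` for CM fields `k`, `K`. [cite: Shimura1998, §18.2 Lemma (i)] -/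
theorem complexConj_apply_ringHom [IsCMField k] (e : k →+* K) (x : k) :
    IsCMField.complexConj K (e x) = e (IsCMField.complexConj k x) := by
  let φ : K →+* ℂ := Classical.choice inferInstance
  apply φ.injective
  rw [IsCMField.complexEmbedding_complexConj]
  have h1 : (φ.comp e) (IsCMField.complexConj k x) = conj ((φ.comp e) x) := IsCMField.complexEmbedding_complexConj k _ x
  exact h1.symm

/-- `x ∘ ρ = x̄` on embeddings. [cite: Shimura1998, §18.1] -/
theorem comp_complexConj_eq_conj_smul (x : K →+* ℂ) :
    x.comp (IsCMField.complexConj K).toRingEquiv.toRingHom = (starRingAut : ℂ ≃+* ℂ) • x :=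
  RingHom.ext fun t => by
    rw [ringEquiv_smul_apply, RingHom.comp_apply]
    exact IsCMField.complexEmbedding_complexConj K x t

end Conj

/-! ### §3 Anti-real generators -/

section Generators

variable {k K : Type} [Field k] [NumberField k] [IsCMField k] [Field K] [NumberField K] [IsCMField K]

/-- **An anti-real element `a ≠ 0` of a CM field** (`a = t − t̄` for `t ∉ k⁺`). [cite: Shimura1998, §18.1] -/
theorem exists_antireal : ∃ a : k, a ≠ 0 ∧ IsCMField.complexConj k a = -a := by
  have h1 : ∃ t : k, IsCMField.complexConj k t ≠ t := by
    by_contra h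
    rw [not_exists] at h
    exact IsCMField.complexConj_ne_one k (AlgEquiv.ext fun t => not_not.1 (h t))
  obtain ⟨t, ht⟩ := h1
  refine ⟨t - IsCMField.complexConj k t, sub_ne_zero.2 (Ne.symm ht), ?_⟩
  rw [map_sub, IsCMField.complexConj_apply_apply]; ring

/-- **`k = k⁺ ⊕ k⁺ a`**: `x = (x + x̄)/2 + ((x − x̄)/(2a))·a` with both coefficients real. [cite: Shimura1998, §18.1] -/
theorem exists_real_add_real_mul {a : k} (ha0 : a ≠ 0) (ha : IsCMField.complexConj k a = -a)
    (x : k) : ∃ r s : k, IsCMField.complexConj k r = r ∧ IsCMField.complexConj k s = s ∧ x = r + s * a := by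
  refine ⟨(x + IsCMField.complexConj k x) / 2, (x - IsCMField.complexConj k x) / (2 * a), ?_, ?_, ?_⟩
  · rw [map_div₀, map_add, IsCMField.complexConj_apply_apply, map_ofNat, add_comm]
  · rw [map_div₀, map_sub, IsCMField.complexConj_apply_apply, map_mul, map_ofNat, ha]
    field_simp
    ring
  · field_simp
    ring

/-- **An anti-real, `τ`-anti element `b ≠ 0` of `K`** (`ρb = −b`, `τb = −b`): an anti-real element of the SECOND
subfield `k′ = Fix(ρτ)`, e.g. `√(Δd) = √Δ·√d`. [cite: Shimura1998, §8.4 (2)(C)] -/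
theorem exists_antireal_anti (e : k →+* K) (h2 : finrank ℚ K = 2 * finrank ℚ k) (τ : K ≃ₐ[ℚ] K) (hτ1 : τ ≠ 1)
    (hτe : ∀ x : k, τ (e x) = e x) :
    ∃ b : K, b ≠ 0 ∧ IsCMField.complexConj K b = -b ∧ τ b = -b := by
  have hττ := algEquiv_over_apply_apply e h2 τ hτ1 hτe
  have h1 : ∃ u : K, τ u ≠ u := by
    by_contra h
    rw [not_exists] at h
    exact hτ1 (AlgEquiv.ext fun t => not_not.1 (h t))
  obtain ⟨u, hu⟩ := h1
  set v : K := u - τ u with hv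
  have hv0 : v ≠ 0 := sub_ne_zero.2 (Ne.symm hu)
  have hτv : τ v = -v := by rw [hv, map_sub, hττ]; ring
  by_cases hρv : IsCMField.complexConj K v = -v
  · exact ⟨v, hv0, hρv, hτv⟩
  · set w : K := v + IsCMField.complexConj K v with hw
    have hw0 : w ≠ 0 := fun h => hρv (by rw [hw] at h; linear_combination h)
    have hρw : IsCMField.complexConj K w = w := by rw [hw, map_add, IsCMField.complexConj_apply_apply, add_comm]
    have hτw : τ w = -w := by rw [hw, map_add, ← complexConj_comm, hτv, map_neg]; ring
    obtain ⟨a, ha0, ha⟩ := exists_antireal (k := k)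
    refine ⟨e a * w, mul_ne_zero ((map_ne_zero e).2 ha0) hw0, ?_, ?_⟩
    · rw [map_mul, complexConj_apply_ringHom, ha, hρw, map_neg]; ring
    · rw [map_mul, hτe, hτw]; ring

/-- **`b² ∈ e(k⁺)`** for such `b`. [cite: Shimura1998, §8.4 (2)(C)] -/
theorem exists_real_apply_eq_mul_self (e : k →+* K) (h2 : finrank ℚ K = 2 * finrank ℚ k) (τ : K ≃ₐ[ℚ] K)
    (hτ1 : τ ≠ 1) (hτe : ∀ x : k, τ (e x) = e x) {b : K} (hρb : IsCMField.complexConj K b = -b) (hτb : τ b = -b) :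
    ∃ r : k, IsCMField.complexConj k r = r ∧ e r = b * b := by
  obtain ⟨r, hr⟩ := exists_apply_eq_of_fix e h2 τ hτ1 hτe (t := b * b) (by rw [map_mul, hτb]; ring)
  refine ⟨r, e.injective ?_, hr⟩
  rw [← complexConj_apply_ringHom, hr, map_mul, hρb]; ring

end Generators

/-! ### §4 The real base field `F = normalClosure ℚ k⁺ ℂ = z(k⁺)` -/

section RealBase

variable {k : Type} [Field k] [NumberField k] [IsCMField k]

/-- `z(r) ∈ F` for every real `r ∈ k⁺` and EVERY place `z`. [cite: Shimura1998, §8.1] -/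
theorem apply_mem_normalClosure (z : k →+* ℂ) {r : k} (hr : IsCMField.complexConj k r = r) :
    z r ∈ IntermediateField.normalClosure ℚ (maximalRealSubfield k) ℂ := by
  have hr' : r ∈ maximalRealSubfield k := (IsCMField.complexConj_eq_self_iff k r).1 hr
  let zr : maximalRealSubfield k →ₐ[ℚ] ℂ := (z.comp (maximalRealSubfield k).subtype).toRatAlgHom
  have h1 : z r ∈ zr.fieldRange := ⟨⟨r, hr'⟩, rfl⟩
  exact AlgHom.fieldRange_le_normalClosure zr h1

/-- `[k⁺ : ℚ] = 2` for a quartic CM field. [cite: Shimura1998, §18.1] -/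
theorem finrank_maximalRealSubfield (hk : finrank ℚ k = 4) : finrank ℚ (maximalRealSubfield k) = 2 := by
  haveI : IsScalarTower ℚ (maximalRealSubfield k) k :=
    IsScalarTower.of_algebraMap_eq fun q => (map_ratCast (algebraMap (maximalRealSubfield k) k) q).symm
  have h := Module.finrank_mul_finrank ℚ (maximalRealSubfield k) k
  rw [hk, Algebra.IsQuadraticExtension.finrank_eq_two (maximalRealSubfield k) k] at h
  omega

/-- `F ⊆ z(k⁺)` for every place `z` (`k⁺` quadratic is normal). [cite: Shimura1998, §8.1] -/
theorem exists_apply_eq_of_mem_normalClosure (hk : finrank ℚ k = 4) (z : k →+* ℂ) {t : ℂ}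
    (ht : t ∈ IntermediateField.normalClosure ℚ (maximalRealSubfield k) ℂ) : ∃ r : k, IsCMField.complexConj k r = r ∧ z r = t := by
  haveI : Algebra.IsQuadraticExtension ℚ (maximalRealSubfield k) := ⟨finrank_maximalRealSubfield hk⟩
  obtain ⟨⟨r, hr⟩, h⟩ := normalClosure_le_range_of_normal (z.comp (maximalRealSubfield k).subtype) ht
  exact ⟨r, (IsCMField.complexConj_eq_self_iff k r).2 hr, h⟩

/-- `F ⊂ ℝ`: complex conjugation fixes `F` pointwise. [cite: Shimura1998, §8.1] -/
theorem conj_apply_of_mem_normalClosure (hk : finrank ℚ k = 4) {t : ℂ}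
    (ht : t ∈ IntermediateField.normalClosure ℚ (maximalRealSubfield k) ℂ) : conj t = t := by
  let z : k →+* ℂ := Classical.choice inferInstance
  obtain ⟨r, hr, rfl⟩ := exists_apply_eq_of_mem_normalClosure hk z ht
  rw [← IsCMField.complexEmbedding_complexConj k z r, hr]

end RealBase

/-! ### §5 Places agreeing on `k⁺`; embeddings agreeing on `e(k⁺)` and at `b` -/

section Fibres

variable {k K : Type} [Field k] [NumberField k] [IsCMField k] [Field K] [NumberField K] [IsCMField K]

/-- **Two places agreeing on `k⁺` are equal or conjugate** (`w(a)² = z(a²) = z(a)²`). [cite: Shimura1998, §18.1] -/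
theorem eq_or_eq_conj_smul_of_forall_real {a : k} (ha0 : a ≠ 0) (ha : IsCMField.complexConj k a = -a)
    (w z : k →+* ℂ) (h : ∀ r : k, IsCMField.complexConj k r = r → w r = z r) :
    w = z ∨ w = (starRingAut : ℂ ≃+* ℂ) • z := by
  have haa : IsCMField.complexConj k (a * a) = a * a := by rw [map_mul, ha]; ring
  have hsq : w a * w a = z a * z a := by rw [← map_mul, ← map_mul, h _ haa]
  rcases mul_self_eq_mul_self_iff.1 hsq with hwa | hwa
  · left
    refine RingHom.ext fun x => ?_
    obtain ⟨r, s, hr, hs, rfl⟩ := exists_real_add_real_mul ha0 ha x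
    rw [map_add, map_mul, map_add, map_mul, h r hr, h s hs, hwa]
  · right
    have e1 : ∀ r : k, IsCMField.complexConj k r = r → star (z r) = z r := fun r hr => by
      rw [← starRingEnd_apply, ← IsCMField.complexEmbedding_complexConj k z r, hr]
    have e3 : star (z a) = -z a := by
      rw [← starRingEnd_apply, ← IsCMField.complexEmbedding_complexConj k z a, ha, map_neg]
    refine RingHom.ext fun x => ?_
    obtain ⟨r, s, hr, hs, rfl⟩ := exists_real_add_real_mul ha0 ha x
    simp only [map_add, map_mul, h r hr, h s hs, hwa, ringEquiv_smul_apply, starRingAut_apply, e1 r hr, e1 s hs, e3]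

/-- **An embedding agreeing with `x` on `e(k⁺)` and at `b` is `x` or `\overline{x ∘ τ}`** — the two extensions of the
place `x|_{k′}` of the second subfield `k′ = e(k⁺)(b)`, obtained without constructing `k′`: `y ∘ e ∈ {x∘e, \overline{x∘e}}`
(§5), then `y ∈ {x, x∘τ}` resp. `{x̄, \overline{x∘τ}}` (§1), and `τb = −b`, `ρb = −b` exclude `x∘τ`, `x̄`.
[cite: Shimura1998, §8.4 (2)(C) and §18.1] -/
theorem eq_or_eq_conj_smul_comp_of_agree (e : k →+* K) (h2 : finrank ℚ K = 2 * finrank ℚ k) (τ : K ≃ₐ[ℚ] K)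
    (hτ1 : τ ≠ 1) (hτe : ∀ x : k, τ (e x) = e x) {a : k} (ha0 : a ≠ 0) (ha : IsCMField.complexConj k a = -a)
    {b : K} (hb0 : b ≠ 0) (hρb : IsCMField.complexConj K b = -b) (hτb : τ b = -b) (x y : K →+* ℂ)
    (hre : ∀ r : k, IsCMField.complexConj k r = r → y (e r) = x (e r)) (hyb : y b = x b) :
    y = x ∨ y = (starRingAut : ℂ ≃+* ℂ) • x.comp τ.toRingEquiv.toRingHom := by
  have hxb : x b ≠ 0 := (map_ne_zero x).2 hb0
  rcases eq_or_eq_conj_smul_of_forall_real ha0 ha (y.comp e) (x.comp e) (fun r hr => hre r hr) with h | h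
  · -- `y` over the same place as `x`
    rcases (comp_eq_comp_iff e h2 τ hτ1 hτe x y).1 h with h' | h'
    · exact Or.inl h'
    · exfalso
      have : y b = x (τ b) := by rw [h']; rfl
      rw [hτb, map_neg, hyb] at this
      exact hxb (by linear_combination this / 2)
  · -- `y` over the conjugate place: compare with `x̄ = x ∘ ρ`
    have h1 : y.comp e = ((starRingAut : ℂ ≃+* ℂ) • x).comp e := h
    rcases (comp_eq_comp_iff e h2 τ hτ1 hτe ((starRingAut : ℂ ≃+* ℂ) • x) y).1 h1 with h' | h'
    · exfalso
      have : y b = conj (x b) := by rw [h']; rfl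
      rw [← IsCMField.complexEmbedding_complexConj K x b, hρb, map_neg, hyb] at this
      exact hxb (by linear_combination this / 2)
    · right
      rw [h']
      rfl

end Fibres

end Summit.HodgeConjecture.CorCM.OcticOverQuartic

end
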